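import Mathlib.Analysis.Calculus.Deriv.Inv
import Literature.Geometry.Lorentzian.CoordScalarCurvatureEvolution
import HarnessLib

/-!
# The scalar curvature of a conformal metric `c · g` from its components:
# `S(ψ⁴ g) = ψ⁻⁵ (S(g) ψ − 8 Δ_g ψ)` in dimension three

Pure Fréchet calculus on a finite-dimensional real normed space `E`, continuing
`CoordCurvature.lean` / `CoordBianchi.lean` / `CoordScalarCurvatureEvolution.lean` (namespace
`MetricCoord`; the coordinate Hessian `hessAt` and Laplacian `lapAt` are taken from the last):
`G : E → (E →L E →L ℝ)` are the components of a pseudo-Riemannian metric, smooth, symmetric and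
nondegenerate on an open set `V` (`IsMetricOn G V`), with Christoffel map `Γ = chrAt G`,
curvature `riemAt G`, Ricci form `ricAt G`, metric trace `mtrAt G` and scalar curvature
`scalAt G`. For a smooth nowhere-vanishing function `c` on `V` we compute the same objects for
the **conformal components** `G' = c · G` (`y ↦ c y • G y`):

* `isMetricOn_conformal`, `sharpAt_conformal` (`♯' = c⁻¹ ♯`), `fderiv_conformal_apply`,
  `koszulCLM_conformal`;
* `IsMetricOn.chrAt_conformal` — **the Christoffel symbols of a conformal metric**:
  `Γ'(X,Y) = Γ(X,Y) + θ(X) Y + θ(Y) X − G(X,Y) θ♯` with `θ = dc/(2c)` (Besse 1987, Thm. 1.159 (a):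
  for `g' = e^{2f} g`, `∇'_X Y = ∇_X Y + df(X) Y + df(Y) X − g(X,Y) ∇f`; here `e^{2f} = c`,
  `df = θ`);
* `IsMetricOn.riemAt_conformal_apply` — the curvature endomorphism of `G'` on constant fields as
  `R + (D_X C)(Y) − (D_Y C)(X) + Γ_X C_Y + C_X Γ_Y + C_X C_Y − Γ_Y C_X − C_Y Γ_X − C_Y C_X`;
* `IsMetricOn.ricAt_conformal` — **the Ricci tensor of a conformal metric**:
  `Ric' = Ric − (n−2) H + (n−2) θ⊗θ − ((n−2)|θ|² + tr_G H) G`, where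
  `H(X,Y) = (D_X θ)(Y) − θ(Γ(X,Y))` is the covariant Hessian of `f = ½ log |c|` and
  `|θ|² = θ(θ♯)` (Besse 1987, Thm. 1.159 (d));
* `IsMetricOn.scalAt_conformal` — **the scalar curvature of a conformal metric**:
  `S' = c⁻¹ (S − 2(n−1) tr_G H − (n−2)(n−1) |θ|²)` (Besse 1987, Thm. 1.159 (f), printed as
  `S' = e^{−2f}(S + 2(n−1)Δf − (n−2)(n−1)|df|²)` with Besse's `Δ = −tr ∇d`; here `tr_G H` is the
  analyst's `tr ∇df`, hence the sign);
* `IsMetricOn.scalAt_conformal_fourth_power` — in dimension `n = 3` with `c = ψ⁴`: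
  **`S(ψ⁴ G) = ψ⁻⁵ (S(G) ψ − 8 Δ_G ψ)`**, `Δ_G ψ = tr_G (D²ψ − Dψ ∘ Γ)` the coordinate
  Laplace–Beltrami operator (`lapAt` of `CoordScalarCurvatureEvolution.lean`); this is the
  "well-known formula" of Schoen–Yau 1979, p. 49,
  `R̃ = φ⁻⁵(−8Δφ + Rφ)` for `d̃s² = φ⁴ ds²`, and the identity behind the Lichnerowicz equation
  (Bartnik–Isenberg 2004, §4.1), now for an arbitrary (not necessarily flat) background metric
  (the flat case `G = δ` is `OpensChart.scalarCurvature_conformal_fourth_power` of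
  `ChartCurvature.lean`).

Everything is proved; the file introduces no statement of `Prop` type. The traces are computed
in a basis `b` of `E` through `trace_eq_sum_coord` (`tr L = ∑ᵢ bⁱ(L bᵢ)`), each elementary
endomorphism `X ↦ α(X) W` contributing `α(W)` (`sum_clm_mul_coord` and its variants).

Relation to `ConformalChangeChart.lean` / `ConformalChange.lean` (landed concurrently): there
`OpensChart.scalarCurvature_conformalRepr_fourth_power` proves the dimension-three law for the
prelude's metrics on `U : Opens E`, for a Riemannian `g` (expansion of
`OpensChart.scalarCurvature_eq_coord` in a `G(x)`-orthonormal basis), and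
`PseudoRiemannianMetric.scalarCurvature_conformal_fourth_power` / `conformal_scalarCurvature_law`
transport it to Riemannian `3`-manifolds (the prelude's `scalarCurvature` and `dalembertian`).
The present file works in the basis-free `MetricCoord` calculus, for components of any signature
and any dimension, and also records the Christoffel and Ricci transformation laws (Besse 1987,
Thm. 1.159 (a), (d)) and the general-dimension scalar law (f); the link between the `MetricCoord`
objects and the prelude's curvature objects on `U : Opens E` is `ChartMetricCoord.lean`
(`OpensChart.scalarCurvature_eq_scalAt`, `OpensChart.dalembertian_eq_lapAt`).

## References

* A. L. Besse, *Einstein manifolds*, Ergebnisse (3) 10, Springer 1987, Thm. 1.159 (conformal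
  changes of metric: Levi-Civita connection, Ricci and scalar curvature). [Besse1987]
* R. Schoen, S.-T. Yau, *On the proof of the positive mass conjecture in general relativity*,
  Comm. Math. Phys. 65 (1979) 45–76, §2, Step 1, p. 49. [SchoenYauPMT1979]
* R. Bartnik, J. Isenberg, *The constraint equations*, in: The Einstein equations and the large
  scale behavior of gravitational fields, Birkhäuser 2004, §4.1. [BartnikIsenberg2004]
* B. O'Neill, *Semi-Riemannian geometry*, Academic Press 1983, Ch. 3, Prop. 3.13, Lemma 3.38,
  Lemma 3.52, Def. 3.53. [ONeill1983]
-/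

noncomputable section

set_option maxSynthPendingDepth 3

open Set Filter ContinuousLinearMap Module
open scoped Topology ContDiff

namespace Literature.Geometry.Lorentzian

namespace MetricCoord

variable {E : Type*} [NormedAddCommGroup E] [NormedSpace ℝ E]

/-! ### Linear algebra in a basis: traces of elementary endomorphisms -/

section BasisAlgebra

variable {ι : Type*} [Fintype ι] (b : Basis ι ℝ E)

omit [Fintype ι] in
/-- `bⁱ(bᵢ) = 1`. [folklore] -/
theorem coord_self (i : ι) : b.coord i (b i) = 1 := by
  rw [Basis.coord_apply, b.repr_self, Finsupp.single_eq_same]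

/-- The trace of the identity in a basis: `∑ᵢ bⁱ(bᵢ) = card ι`. [folklore] -/
theorem sum_coord_self : ∑ i, b.coord i (b i) = Fintype.card ι := by
  simp only [coord_self, Finset.sum_const, Finset.card_univ, nsmul_eq_mul, mul_one]

/-- **The trace of a rank-one endomorphism**: `∑ᵢ α(bᵢ) bⁱ(W) = α(W)` for a linear functional
`α`, i.e. `tr (X ↦ α(X) W) = α(W)`. [folklore] -/
theorem sum_apply_mul_coord (α : E →ₗ[ℝ] ℝ) (W : E) : ∑ i, α (b i) * b.coord i W = α W := by
  conv_rhs => rw [← b.sum_repr W]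
  rw [map_sum]
  refine Finset.sum_congr rfl fun i _ ↦ ?_
  rw [map_smul, smul_eq_mul, mul_comm, Basis.coord_apply]

/-- `∑ᵢ α(bᵢ) bⁱ(W) = α(W)` for a continuous linear functional `α`. [folklore] -/
theorem sum_clm_mul_coord (α : E →L[ℝ] ℝ) (W : E) : ∑ i, α (b i) * b.coord i W = α W := by
  conv_rhs => rw [← b.sum_repr W]
  rw [map_sum]
  refine Finset.sum_congr rfl fun i _ ↦ ?_
  rw [map_smul, smul_eq_mul, mul_comm, Basis.coord_apply]

/-- `∑ᵢ bⁱ(W) α(bᵢ) = α(W)` for a continuous linear functional `α`. [folklore] -/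
theorem sum_coord_mul_clm (α : E →L[ℝ] ℝ) (W : E) : ∑ i, b.coord i W * α (b i) = α W := by
  rw [← sum_clm_mul_coord b α W]
  exact Finset.sum_congr rfl fun i _ ↦ mul_comm _ _

/-- **Reassembling a vector-valued linear map from a basis**: `∑ᵢ bⁱ(W) L(bᵢ) = L(W)`.
[folklore] -/
theorem sum_coord_smul_clm {F : Type*} [AddCommGroup F] [Module ℝ F] (L : E →ₗ[ℝ] F) (W : E) :
    ∑ i, b.coord i W • L (b i) = L W := by
  conv_rhs => rw [← b.sum_repr W]
  rw [map_sum]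
  refine Finset.sum_congr rfl fun i _ ↦ ?_
  rw [map_smul, Basis.coord_apply]

end BasisAlgebra


/-! ### The conformal one-form `θ = dc/(2c)`, its dual vector and the difference tensor -/

section ConformalData

variable (G : E → E →L[ℝ] E →L[ℝ] ℝ) (c : E → ℝ)

/-- The **conformal one-form** `θ_y = dc(y) / (2 c(y))`, i.e. `θ = df` for `c = e^{2f}`
(`f = ½ log |c|`). [cite: Besse1987, Thm. 1.159] -/
def confForm (y : E) : E →L[ℝ] ℝ :=
  (2 * c y)⁻¹ • fderiv ℝ c y

/-- Unfolding lemma: `θ_y(v) = ∂_v c(y) / (2 c(y))`. [folklore] -/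
theorem confForm_apply (y v : E) : confForm c y v = (2 * c y)⁻¹ * fderiv ℝ c y v := rfl

/-- The **conformal vector field** `T = θ♯ = grad_G f`. [cite: Besse1987, Thm. 1.159] -/
def confVec (y : E) : E :=
  sharpAt G y (confForm c y)

/-- The **difference tensor** of the two Levi-Civita connections on constant fields:
`C_y(X, Y) = θ(X) Y + θ(Y) X − G_y(X, Y) T` (Besse 1987, Thm. 1.159 (a)).
[cite: Besse1987, Thm. 1.159 (a)] -/
def confDiff (y X Y : E) : E :=
  confForm c y X • Y + confForm c y Y • X - G y X Y • confVec G c y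

/-- The **covariant Hessian of `f = ½ log |c|`** on constant fields at `x`:
`H_x(v, w) = ∂_v θ(w) − θ(Γ_x(v, w))` (`= (∇df)(v,w)`; O'Neill 1983, Ch. 3, Def. 3.48 with
Lemma 3.49). [cite: ONeill1983, Ch. 3, Lemma 3.49] -/
def confHess (x : E) : E →L[ℝ] E →L[ℝ] ℝ :=
  fderiv ℝ (confForm c) x -
    (ContinuousLinearMap.compL ℝ E E ℝ (confForm c x)).comp (chrAt G x)

variable {G c}

/-- Unfolding lemma: `H_x(v, w) = Dθ(x)(v)(w) − θ_x(Γ_x(v, w))`. [folklore] -/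
@[simp]
theorem confHess_apply (x v w : E) :
    confHess G c x v w = fderiv ℝ (confForm c) x v w - confForm c x (chrAt G x v w) := by
  simp [confHess]

/-- `C` is additive in its second slot. [folklore] -/
theorem confDiff_add_right (y X Y₁ Y₂ : E) :
    confDiff G c y X (Y₁ + Y₂) = confDiff G c y X Y₁ + confDiff G c y X Y₂ := by
  simp only [confDiff, map_add, smul_add, add_smul]
  abel

/-- `C` is homogeneous in its second slot. [folklore] -/
theorem confDiff_smul_right (y X : E) (a : ℝ) (Y : E) :
    confDiff G c y X (a • Y) = a • confDiff G c y X Y := by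
  simp only [confDiff, map_smul, smul_eq_mul, smul_sub, smul_add, smul_smul, mul_comm a]

/-- `C` is additive in its first slot. [folklore] -/
theorem confDiff_add_left (y X₁ X₂ Y : E) :
    confDiff G c y (X₁ + X₂) Y = confDiff G c y X₁ Y + confDiff G c y X₂ Y := by
  simp only [confDiff, map_add, smul_add, add_smul, _root_.add_apply]
  abel

/-- `C` is homogeneous in its first slot. [folklore] -/
theorem confDiff_smul_left (y : E) (a : ℝ) (X Y : E) :
    confDiff G c y (a • X) Y = a • confDiff G c y X Y := by
  simp only [confDiff, map_smul, smul_eq_mul, smul_sub, smul_add, smul_smul, _root_.smul_apply,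
    mul_comm a]

/-- `θ(C(Y, Z)) = 2 θ(Y) θ(Z) − G(Y,Z) θ(T)`. [folklore] -/
theorem confForm_confDiff (y Y Z : E) :
    confForm c y (confDiff G c y Y Z) =
      2 * (confForm c y Y * confForm c y Z) - G y Y Z * confForm c y (confVec G c y) := by
  simp only [confDiff, map_add, map_sub, map_smul, smul_eq_mul]
  ring

/-- `C` is symmetric when `G_y` is. [folklore] -/
theorem confDiff_comm {y : E} (hs : ∀ v w : E, G y v w = G y w v) (X Y : E) :
    confDiff G c y X Y = confDiff G c y Y X := by
  simp only [confDiff, hs X Y]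
  abel

/-- `G_x(T, w) = θ(w)`: the conformal vector is the metric dual of `θ`. [folklore] -/
theorem apply_confVec {x : E} (hx : (G x).IsInvertible) (w : E) :
    G x (confVec G c x) w = confForm c x w :=
  apply_sharpAt_apply hx _ w

/-- `G_x(w, T) = θ(w)` for symmetric `G_x`. [folklore] -/
theorem apply_apply_confVec {x : E} (hx : (G x).IsInvertible) (hs : ∀ v w : E, G x v w = G x w v)
    (w : E) : G x w (confVec G c x) = confForm c x w := by
  rw [hs, apply_confVec hx]

end ConformalData

/-! ### The conformal components `c · G`: metric, `♯`, derivative, Koszul form -/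

section Conformal

variable {G : E → E →L[ℝ] E →L[ℝ] ℝ} {V : Set E} {x : E} {c : E → ℝ}

/-- Invertible symmetric components are nondegenerate: `G_x(v, ·) = 0 ⇒ v = 0`. [folklore] -/
theorem eq_zero_of_forall_apply_eq_zero (hx : (G x).IsInvertible) {v : E}
    (hv : ∀ w, G x v w = 0) : v = 0 := by
  have h0 : G x v = 0 := by
    ext w
    exact hv w
  rw [← sharpAt_apply hx v, h0, map_zero]

/-- **The conformal components are metric components**: if `G` is a metric on `V` and `c` is
smooth and nowhere zero on `V`, so is `c · G` (O'Neill 1983, Ch. 3, Def. 3.1; Besse 1987, 1.159).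
[cite: Besse1987, Thm. 1.159] -/
theorem isMetricOn_conformal [FiniteDimensional ℝ E] (hG : IsMetricOn G V) (hc : ContDiffOn ℝ ∞ c V)
    (hc0 : ∀ y ∈ V, c y ≠ 0) : IsMetricOn (fun y ↦ c y • G y) V where
  isOpen := hG.isOpen
  contDiffOn := hc.smul hG.contDiffOn
  symm y hy v w := by
    simp only [_root_.smul_apply, smul_eq_mul, hG.symm y hy v w]
  isInvertible y hy := by
    refine isInvertible_of_nondegenerate fun v hv ↦ ?_
    refine eq_zero_of_forall_apply_eq_zero (hG.isInvertible y hy) fun w ↦ ?_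
    have h := hv w
    simp only [_root_.smul_apply, smul_eq_mul, mul_eq_zero] at h
    exact h.resolve_left (hc0 y hy)

/-- Evaluation of the conformal components: `(c · G)_y(v, w) = c(y) G_y(v, w)`. [folklore] -/
theorem conformal_apply (y v w : E) : (fun y ↦ c y • G y) y v w = c y * G y v w := rfl

/-- **Index raising for the conformal components**: `♯' = c⁻¹ ♯`. [cite: Besse1987, Thm. 1.159] -/
theorem sharpAt_conformal (hx : (G x).IsInvertible) (hx' : ((fun y ↦ c y • G y) x).IsInvertible)
    (hcx : c x ≠ 0) (α : E →L[ℝ] ℝ) :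
    sharpAt (fun y ↦ c y • G y) x α = (c x)⁻¹ • sharpAt G x α := by
  refine sharpAt_eq_of_forall hx' fun w ↦ ?_
  simp only [_root_.smul_apply, smul_eq_mul, map_smul, apply_sharpAt_apply hx]
  field_simp

/-- **The derivative of the conformal components**:
`∂_v (c G)(Y, Z) = c ∂_v G(Y,Z) + ∂_v c · G(Y,Z)`. [folklore] -/
theorem hasFDerivAt_conformal (hGx : DifferentiableAt ℝ G x) (hcx : DifferentiableAt ℝ c x) :
    HasFDerivAt (fun y ↦ c y • G y) (c x • fderiv ℝ G x + (fderiv ℝ c x).smulRight (G x)) x :=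
  hcx.hasFDerivAt.smul hGx.hasFDerivAt

/-- `fderiv` form of `hasFDerivAt_conformal`, evaluated:
`D(cG)(x)(v)(Y)(Z) = c(x) DG(x)(v)(Y)(Z) + Dc(x)(v) G_x(Y,Z)`. [folklore] -/
theorem fderiv_conformal_apply (hGx : DifferentiableAt ℝ G x) (hcx : DifferentiableAt ℝ c x)
    (v Y Z : E) :
    fderiv ℝ (fun y ↦ c y • G y) x v Y Z = c x * fderiv ℝ G x v Y Z + fderiv ℝ c x v * G x Y Z := by
  rw [(hasFDerivAt_conformal hGx hcx).fderiv]
  simp only [_root_.add_apply, _root_.smul_apply, smul_eq_mul,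
    ContinuousLinearMap.smulRight_apply]

/-- **The Koszul form of the conformal components**:
`K'(X,Y,Z) = c K(X,Y,Z) + ∂_X c G(Y,Z) + ∂_Y c G(Z,X) − ∂_Z c G(X,Y)`.
[cite: Besse1987, Thm. 1.159] -/
theorem koszulCLM_conformal (hGx : DifferentiableAt ℝ G x) (hcx : DifferentiableAt ℝ c x)
    (X Y Z : E) :
    koszulCLM (fun y ↦ c y • G y) x X Y Z =
      c x * koszulCLM G x X Y Z + fderiv ℝ c x X * G x Y Z + fderiv ℝ c x Y * G x Z X
        - fderiv ℝ c x Z * G x X Y := by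
  simp only [koszulCLM_apply, fderiv_conformal_apply hGx hcx]
  ring

/-- **The Christoffel symbols of a conformal metric** (Besse 1987, Thm. 1.159 (a): for
`g' = e^{2f} g`, `∇'_X Y = ∇_X Y + df(X) Y + df(Y) X − g(X,Y) grad f`). With `c = e^{2f}`,
`θ = df = dc/(2c)` and `T = θ♯`:
`Γ'(X,Y) = Γ(X,Y) + θ(X) Y + θ(Y) X − G(X,Y) T`. [cite: Besse1987, Thm. 1.159 (a)] -/
theorem IsMetricOn.chrAt_conformal (hG : IsMetricOn G V) (hx : x ∈ V)
    (hcx : DifferentiableAt ℝ c x) (hc0 : c x ≠ 0)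
    (hx' : ((fun y ↦ c y • G y) x).IsInvertible) (X Y : E) :
    chrAt (fun y ↦ c y • G y) x X Y =
      chrAt G x X Y + (((2 * c x)⁻¹ • fderiv ℝ c x) X • Y + ((2 * c x)⁻¹ • fderiv ℝ c x) Y • X
        - G x X Y • sharpAt G x ((2 * c x)⁻¹ • fderiv ℝ c x)) := by
  have hi := hG.isInvertible x hx
  -- both sides have the same pairing with `c G` against every `Z`
  have key : ∀ Z, (fun y ↦ c y • G y) x (chrAt (fun y ↦ c y • G y) x X Y) Z =
      (fun y ↦ c y • G y) x (chrAt G x X Y + (((2 * c x)⁻¹ • fderiv ℝ c x) X • Y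
        + ((2 * c x)⁻¹ • fderiv ℝ c x) Y • X
        - G x X Y • sharpAt G x ((2 * c x)⁻¹ • fderiv ℝ c x))) Z := fun Z ↦ by
    rw [apply_chrAt (G := fun y ↦ c y • G y) hx', koszulCLM_conformal (hG.differentiableAt hx) hcx]
    simp only [map_add, map_sub, map_smul, _root_.add_apply, _root_.sub_apply,
      _root_.smul_apply, smul_eq_mul, apply_chrAt hi, apply_sharpAt_apply hi,
      hG.symm x hx Z X]
    field_simp
    ring
  have hfun : (fun y ↦ c y • G y) x (chrAt (fun y ↦ c y • G y) x X Y) =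
      (fun y ↦ c y • G y) x (chrAt G x X Y + (((2 * c x)⁻¹ • fderiv ℝ c x) X • Y
        + ((2 * c x)⁻¹ • fderiv ℝ c x) Y • X
        - G x X Y • sharpAt G x ((2 * c x)⁻¹ • fderiv ℝ c x))) := by
    ext Z
    exact key Z
  rw [← sharpAt_apply (G := fun y ↦ c y • G y) hx' (chrAt (fun y ↦ c y • G y) x X Y), hfun,
    sharpAt_apply (G := fun y ↦ c y • G y) hx']

/-- **The Christoffel symbols of a conformal metric**, difference-tensor form:
`Γ' = Γ + C` on `V` (Besse 1987, Thm. 1.159 (a)). [cite: Besse1987, Thm. 1.159 (a)] -/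
theorem IsMetricOn.chrAt_conformal_eq [FiniteDimensional ℝ E] (hG : IsMetricOn G V)
    (hc : ContDiffOn ℝ ∞ c V) (hc0 : ∀ y ∈ V, c y ≠ 0) {y : E} (hy : y ∈ V) (X Y : E) :
    chrAt (fun y ↦ c y • G y) y X Y = chrAt G y X Y + confDiff G c y X Y := by
  have hcy : DifferentiableAt ℝ c y :=
    ((hc y hy).contDiffAt (hG.mem_nhds hy)).differentiableAt (by simp)
  rw [hG.chrAt_conformal hy hcy (hc0 y hy) ((isMetricOn_conformal hG hc hc0).isInvertible y hy)]
  simp only [confDiff, confVec, confForm]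

end Conformal

/-! ### Calculus of the conformal data on `V` -/

section ConformalCalculus

variable {G : E → E →L[ℝ] E →L[ℝ] ℝ} {V : Set E} {x : E} {c : E → ℝ}

/-- `c` is differentiable at the points of `V`. [folklore] -/
theorem IsMetricOn.differentiableAt_of_contDiffOn (hG : IsMetricOn G V) (hc : ContDiffOn ℝ ∞ c V)
    (hx : x ∈ V) : DifferentiableAt ℝ c x :=
  ((hc x hx).contDiffAt (hG.mem_nhds hx)).differentiableAt (by simp)

/-- `c` is `C^∞` at the points of `V`. [folklore] -/
theorem IsMetricOn.contDiffAt_of_contDiffOn (hG : IsMetricOn G V) (hc : ContDiffOn ℝ ∞ c V)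
    (hx : x ∈ V) : ContDiffAt ℝ ∞ c x :=
  (hc x hx).contDiffAt (hG.mem_nhds hx)

/-- The conformal one-form `θ = dc/(2c)` is `C^∞` on `V`. [folklore] -/
theorem IsMetricOn.contDiffOn_confForm (hG : IsMetricOn G V) (hc : ContDiffOn ℝ ∞ c V)
    (hc0 : ∀ y ∈ V, c y ≠ 0) : ContDiffOn ℝ ∞ (confForm c) V := by
  have h2 : ContDiffOn ℝ ∞ (fun y ↦ (2 * c y)⁻¹) V :=
    (contDiffOn_const.mul hc).inv fun y hy ↦ mul_ne_zero two_ne_zero (hc0 y hy)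
  exact h2.smul (hc.fderiv_of_isOpen hG.isOpen (by simp))

/-- `θ` is `C^∞` at the points of `V`. [folklore] -/
theorem IsMetricOn.contDiffAt_confForm (hG : IsMetricOn G V) (hc : ContDiffOn ℝ ∞ c V)
    (hc0 : ∀ y ∈ V, c y ≠ 0) (hx : x ∈ V) : ContDiffAt ℝ ∞ (confForm c) x :=
  (hG.contDiffOn_confForm hc hc0 x hx).contDiffAt (hG.mem_nhds hx)

/-- `θ` is differentiable at the points of `V`. [folklore] -/
theorem IsMetricOn.differentiableAt_confForm (hG : IsMetricOn G V) (hc : ContDiffOn ℝ ∞ c V)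
    (hc0 : ∀ y ∈ V, c y ≠ 0) (hx : x ∈ V) : DifferentiableAt ℝ (confForm c) x :=
  (hG.contDiffAt_confForm hc hc0 hx).differentiableAt (by simp)

/-- **The derivative of `θ = dc/(2c)`**:
`Dθ(x)(v)(w) = D²c(x)(v,w)/(2c) − 2 ∂_v c ∂_w c/(2c)²`. [folklore] -/
theorem IsMetricOn.fderiv_confForm_apply (hG : IsMetricOn G V) (hc : ContDiffOn ℝ ∞ c V)
    (hc0 : ∀ y ∈ V, c y ≠ 0) (hx : x ∈ V) (v w : E) :
    fderiv ℝ (confForm c) x v w =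
      (2 * c x)⁻¹ * fderiv ℝ (fderiv ℝ c) x v w
        - ((2 * c x) ^ 2)⁻¹ * (2 * fderiv ℝ c x v) * fderiv ℝ c x w := by
  have hcd : HasFDerivAt c (fderiv ℝ c x) x := (hG.differentiableAt_of_contDiffOn hc hx).hasFDerivAt
  have h2c : HasFDerivAt (fun y ↦ 2 * c y) ((2 : ℝ) • fderiv ℝ c x) x := hcd.const_mul 2
  have hinv : HasFDerivAt (fun y ↦ (2 * c y)⁻¹)
      ((-((2 * c x) ^ 2)⁻¹) • ((2 : ℝ) • fderiv ℝ c x)) x :=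
    (hasDerivAt_inv (mul_ne_zero two_ne_zero (hc0 x hx))).comp_hasFDerivAt x h2c
  have hD : HasFDerivAt (fderiv ℝ c) (fderiv ℝ (fderiv ℝ c) x) x := by
    have h := ((hG.contDiffAt_of_contDiffOn hc hx).fderiv_right (m := ∞) (by simp)).differentiableAt
      (by simp)
    exact h.hasFDerivAt
  have hθ : HasFDerivAt (confForm c)
      ((2 * c x)⁻¹ • fderiv ℝ (fderiv ℝ c) x
        + ((-((2 * c x) ^ 2)⁻¹) • ((2 : ℝ) • fderiv ℝ c x)).smulRight (fderiv ℝ c x)) x :=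
    hinv.smul hD
  rw [hθ.fderiv]
  simp only [_root_.add_apply, _root_.smul_apply, smul_eq_mul,
    ContinuousLinearMap.smulRight_apply]
  ring

/-- The derivative of `θ` is symmetric: `Dθ(x)(v)(w) = Dθ(x)(w)(v)` (`θ` is closed, being
`d(½ log |c|)`; symmetry of `D²c`). [folklore] -/
theorem IsMetricOn.fderiv_confForm_comm (hG : IsMetricOn G V) (hc : ContDiffOn ℝ ∞ c V)
    (hc0 : ∀ y ∈ V, c y ≠ 0) (hx : x ∈ V) (v w : E) :
    fderiv ℝ (confForm c) x v w = fderiv ℝ (confForm c) x w v := by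
  rw [hG.fderiv_confForm_apply hc hc0 hx, hG.fderiv_confForm_apply hc hc0 hx,
    ((hG.contDiffAt_of_contDiffOn hc hx).isSymmSndFDerivAt two_le_infty).eq v w]
  ring

variable [CompleteSpace E]

/-- `T = θ♯` is `C^∞` on `V`. [folklore] -/
theorem IsMetricOn.contDiffOn_confVec (hG : IsMetricOn G V) (hc : ContDiffOn ℝ ∞ c V)
    (hc0 : ∀ y ∈ V, c y ≠ 0) : ContDiffOn ℝ ∞ (confVec G c) V :=
  hG.contDiffOn_sharpAt.clm_apply (hG.contDiffOn_confForm hc hc0)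

/-- **The derivative of `T = θ♯`**: `∂_v T = ♯(Dθ(v)) − ♯(∂_v G(T, ·))`
(`∂_v ♯ = −♯ ∘ ∂_v G ∘ ♯`, `IsMetricOn.fderiv_sharpAt`). [folklore] -/
theorem IsMetricOn.hasFDerivAt_confVec (hG : IsMetricOn G V) (hc : ContDiffOn ℝ ∞ c V)
    (hc0 : ∀ y ∈ V, c y ≠ 0) (hx : x ∈ V) :
    HasFDerivAt (confVec G c)
      ((sharpAt G x).comp (fderiv ℝ (confForm c) x)
        + (fderiv ℝ (sharpAt G) x).flip (confForm c x)) x :=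
  (hG.differentiableAt_sharpAt hx).hasFDerivAt.clm_apply
    (hG.differentiableAt_confForm hc hc0 hx).hasFDerivAt

/-- `∂_v T = ♯(Dθ(x)(v)) − ♯(DG(x)(v)(T))`. [folklore] -/
theorem IsMetricOn.fderiv_confVec_apply (hG : IsMetricOn G V) (hc : ContDiffOn ℝ ∞ c V)
    (hc0 : ∀ y ∈ V, c y ≠ 0) (hx : x ∈ V) (v : E) :
    fderiv ℝ (confVec G c) x v =
      sharpAt G x (fderiv ℝ (confForm c) x v) - sharpAt G x (fderiv ℝ G x v (confVec G c x)) := by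
  rw [(hG.hasFDerivAt_confVec hc hc0 hx).fderiv, _root_.add_apply, ContinuousLinearMap.comp_apply,
    ContinuousLinearMap.flip_apply, hG.fderiv_sharpAt hx v]
  simp only [_root_.neg_apply, ContinuousLinearMap.comp_apply, confVec]
  abel

/-- **The derivative of the difference tensor** on constant fields:
`∂_v C(Y, Z) = Dθ(v)(Y) Z + Dθ(v)(Z) Y − ∂_v G(Y,Z) T − G(Y,Z) ∂_v T`. [folklore] -/
theorem IsMetricOn.hasFDerivAt_confDiff (hG : IsMetricOn G V) (hc : ContDiffOn ℝ ∞ c V)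
    (hc0 : ∀ y ∈ V, c y ≠ 0) (hx : x ∈ V) (Y Z : E) :
    HasFDerivAt (fun y ↦ confDiff G c y Y Z)
      (((fderiv ℝ (confForm c) x).flip Y).smulRight Z
        + ((fderiv ℝ (confForm c) x).flip Z).smulRight Y
        - (G x Y Z • fderiv ℝ (confVec G c) x
            + (((fderiv ℝ G x).flip Y).flip Z).smulRight (confVec G c x))) x := by
  have hθ := (hG.differentiableAt_confForm hc hc0 hx).hasFDerivAt
  have h1 : HasFDerivAt (fun y ↦ confForm c y Y • Z)
      (((fderiv ℝ (confForm c) x).flip Y).smulRight Z) x :=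
    (hasFDerivAt_clm_apply_const hθ Y).smul_const Z
  have h2 : HasFDerivAt (fun y ↦ confForm c y Z • Y)
      (((fderiv ℝ (confForm c) x).flip Z).smulRight Y) x :=
    (hasFDerivAt_clm_apply_const hθ Z).smul_const Y
  have hGYZ : HasFDerivAt (fun y ↦ G y Y Z) (((fderiv ℝ G x).flip Y).flip Z) x :=
    hasFDerivAt_clm_apply_const
      (hasFDerivAt_clm_apply_const (hG.differentiableAt hx).hasFDerivAt Y) Z
  have hT : HasFDerivAt (confVec G c) (fderiv ℝ (confVec G c) x) x :=
    (hG.hasFDerivAt_confVec hc hc0 hx).differentiableAt.hasFDerivAt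
  have h3 : HasFDerivAt (fun y ↦ G y Y Z • confVec G c y)
      (G x Y Z • fderiv ℝ (confVec G c) x
        + (((fderiv ℝ G x).flip Y).flip Z).smulRight (confVec G c x)) x :=
    hGYZ.smul hT
  exact (h1.add h2).sub h3

/-- Evaluated form of `hasFDerivAt_confDiff`. [folklore] -/
theorem IsMetricOn.fderiv_confDiff_apply (hG : IsMetricOn G V) (hc : ContDiffOn ℝ ∞ c V)
    (hc0 : ∀ y ∈ V, c y ≠ 0) (hx : x ∈ V) (Y Z v : E) :
    fderiv ℝ (fun y ↦ confDiff G c y Y Z) x v =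
      fderiv ℝ (confForm c) x v Y • Z + fderiv ℝ (confForm c) x v Z • Y
        - (fderiv ℝ G x v Y Z • confVec G c x + G x Y Z • fderiv ℝ (confVec G c) x v) := by
  rw [(hG.hasFDerivAt_confDiff hc hc0 hx Y Z).fderiv]
  simp only [_root_.add_apply, _root_.sub_apply, _root_.smul_apply,
    ContinuousLinearMap.smulRight_apply, ContinuousLinearMap.flip_apply]
  abel

/-- **The derivative of the Christoffel map of a conformal metric** on constant fields:
`DΓ'(x)(v)(Y)(Z) = DΓ(x)(v)(Y)(Z) + ∂_v C(Y,Z)` (differentiate `Γ' = Γ + C`, valid near `x`).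
[folklore] -/
theorem IsMetricOn.fderiv_chrAt_conformal_apply [FiniteDimensional ℝ E] (hG : IsMetricOn G V)
    (hc : ContDiffOn ℝ ∞ c V) (hc0 : ∀ y ∈ V, c y ≠ 0) (hx : x ∈ V) (v Y Z : E) :
    fderiv ℝ (chrAt (fun y ↦ c y • G y)) x v Y Z =
      fderiv ℝ (chrAt G) x v Y Z
        + (fderiv ℝ (confForm c) x v Y • Z + fderiv ℝ (confForm c) x v Z • Y
          - (fderiv ℝ G x v Y Z • confVec G c x + G x Y Z • fderiv ℝ (confVec G c) x v)) := by
  have hG' := isMetricOn_conformal hG hc hc0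
  have heq : (fun y ↦ chrAt (fun y ↦ c y • G y) y Y Z) =ᶠ[𝓝 x]
      fun y ↦ chrAt G y Y Z + confDiff G c y Y Z :=
    (hG.eventually_mem hx).mono fun y hy ↦ hG.chrAt_conformal_eq hc hc0 hy Y Z
  have hΓ : HasFDerivAt (fun y ↦ chrAt G y Y Z) (fderiv ℝ (fun y ↦ chrAt G y Y Z) x) x :=
    (differentiableAt_clm_apply_const
      (differentiableAt_clm_apply_const (hG.differentiableAt_chrAt hx) Y) Z).hasFDerivAt
  have hsum := (hΓ.add (hG.hasFDerivAt_confDiff hc hc0 hx Y Z)).congr_of_eventuallyEq heq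
  rw [← hG'.fderiv_chrAt_apply₂ hx Y Z v, hsum.fderiv, _root_.add_apply,
    hG.fderiv_chrAt_apply₂ hx Y Z v]
  simp only [_root_.add_apply, _root_.sub_apply, _root_.smul_apply,
    ContinuousLinearMap.smulRight_apply, ContinuousLinearMap.flip_apply]
  abel

/-- **The curvature endomorphism of a conformal metric on constant fields.** With `Γ' = Γ + C`
(`chrAt_conformal_eq`) and `R' = DΓ' − DΓ' + Γ'Γ' − Γ'Γ'`:
`R'(X,Y)Z = R(X,Y)Z + [∂_X C(Y,Z) − ∂_Y C(X,Z)] + [Γ(X,C(Y,Z)) + C(X,Γ(Y,Z)) + C(X,C(Y,Z))]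
  − [Γ(Y,C(X,Z)) + C(Y,Γ(X,Z)) + C(Y,C(X,Z))]`
(Besse 1987, Thm. 1.159 (b), before contraction). [cite: Besse1987, Thm. 1.159 (b)] -/
theorem IsMetricOn.riemAt_conformal_apply [FiniteDimensional ℝ E] (hG : IsMetricOn G V)
    (hc : ContDiffOn ℝ ∞ c V) (hc0 : ∀ y ∈ V, c y ≠ 0) (hx : x ∈ V) (X Y Z : E) :
    riemAt (fun y ↦ c y • G y) x X Y Z =
      riemAt G x X Y Z
        + ((fderiv ℝ (confForm c) x X Y • Z + fderiv ℝ (confForm c) x X Z • Y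
            - (fderiv ℝ G x X Y Z • confVec G c x + G x Y Z • fderiv ℝ (confVec G c) x X))
          - (fderiv ℝ (confForm c) x Y X • Z + fderiv ℝ (confForm c) x Y Z • X
            - (fderiv ℝ G x Y X Z • confVec G c x + G x X Z • fderiv ℝ (confVec G c) x Y)))
        + ((chrAt G x X (confDiff G c x Y Z) + confDiff G c x X (chrAt G x Y Z)
            + confDiff G c x X (confDiff G c x Y Z))
          - (chrAt G x Y (confDiff G c x X Z) + confDiff G c x Y (chrAt G x X Z)
            + confDiff G c x Y (confDiff G c x X Z))) := by
  rw [riemAt_apply, riemAt_apply, hG.fderiv_chrAt_conformal_apply hc hc0 hx X Y Z,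
    hG.fderiv_chrAt_conformal_apply hc hc0 hx Y X Z, hG.chrAt_conformal_eq hc hc0 hx Y Z,
    hG.chrAt_conformal_eq hc hc0 hx X Z, hG.chrAt_conformal_eq hc hc0 hx X,
    hG.chrAt_conformal_eq hc hc0 hx Y]
  simp only [map_add, confDiff_add_right]
  abel

end ConformalCalculus

/-! ### Traces in a basis of the pieces of `R' − R` -/

section Traces

variable {ι : Type*} [Fintype ι] (b : Basis ι ℝ E) {G : E → E →L[ℝ] E →L[ℝ] ℝ} {V : Set E}
  {x : E} {c : E → ℝ}

/-- `∑ᵢ f(bᵢ) bⁱ(W) = f(W)` for an additive homogeneous `f : E → ℝ`. [folklore] -/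
theorem sum_fun_mul_coord (f : E → ℝ) (hadd : ∀ v w, f (v + w) = f v + f w)
    (hsmul : ∀ (a : ℝ) v, f (a • v) = a * f v) (W : E) :
    ∑ i, f (b i) * b.coord i W = f W := by
  let L : E →ₗ[ℝ] ℝ :=
    { toFun := f
      map_add' := hadd
      map_smul' := fun a v ↦ by rw [hsmul]; rfl }
  exact sum_apply_mul_coord b L W

/-- `∑ᵢ bⁱ(W) F(bᵢ) = F(W)` in `E` for an additive homogeneous `F : E → E`. [folklore] -/
theorem sum_coord_smul_fun (F : E → E) (hadd : ∀ v w, F (v + w) = F v + F w)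
    (hsmul : ∀ (a : ℝ) v, F (a • v) = a • F v) (W : E) :
    ∑ i, b.coord i W • F (b i) = F W := by
  let L : E →ₗ[ℝ] E :=
    { toFun := F
      map_add' := hadd
      map_smul' := fun a v ↦ by rw [hsmul]; rfl }
  exact sum_coord_smul_clm b L W

/-- `∑ᵢ B(bᵢ)(Y) bⁱ(W) = B(W)(Y)` for a continuous bilinear `B`. [folklore] -/
theorem sum_clm₂_mul_coord (B : E →L[ℝ] E →L[ℝ] ℝ) (Y W : E) :
    ∑ i, B (b i) Y * b.coord i W = B W Y :=
  sum_fun_mul_coord b (fun v ↦ B v Y) (fun v w ↦ by simp only [map_add, _root_.add_apply])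
    (fun a v ↦ by simp only [map_smul, _root_.smul_apply, smul_eq_mul]) W

/-- `∑ᵢ D(bᵢ)(Y)(Z) bⁱ(W) = D(W)(Y)(Z)` for a continuous trilinear `D`. [folklore] -/
theorem sum_clm₃_mul_coord (D : E →L[ℝ] E →L[ℝ] E →L[ℝ] ℝ) (Y Z W : E) :
    ∑ i, D (b i) Y Z * b.coord i W = D W Y Z :=
  sum_fun_mul_coord b (fun v ↦ D v Y Z) (fun v w ↦ by simp only [map_add, _root_.add_apply])
    (fun a v ↦ by simp only [map_smul, _root_.smul_apply, smul_eq_mul]) W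

/-- `∑ᵢ a bⁱ(bᵢ) = card ι · a`. [folklore] -/
theorem sum_mul_coord_self (a : ℝ) : ∑ i, a * b.coord i (b i) = Fintype.card ι * a := by
  rw [← Finset.mul_sum, sum_coord_self, mul_comm]

/-- **The covariant trace of `∇T`**: `∑ᵢ bⁱ(∂_{bᵢ} T) + ∑ᵢ bⁱ(Γ(bᵢ, T)) = tr_G H`
(`∇_v T = ∂_v T + Γ(v, T) = ♯ H(v, ·)`, by `∂_v ♯ = −♯ ∂_vG ♯` and metric compatibility).
[folklore] -/
theorem IsMetricOn.sum_coord_fderiv_confVec [CompleteSpace E] (hG : IsMetricOn G V)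
    (hc : ContDiffOn ℝ ∞ c V)
    (hc0 : ∀ y ∈ V, c y ≠ 0) (hx : x ∈ V) :
    ∑ i, b.coord i (fderiv ℝ (confVec G c) x (b i))
      + ∑ i, b.coord i (chrAt G x (b i) (confVec G c x)) = mtrAt G x (confHess G c x) := by
  have hi := hG.isInvertible x hx
  rw [mtrAt, trace_eq_sum_coord b, ← Finset.sum_add_distrib]
  refine Finset.sum_congr rfl fun i _ ↦ ?_
  rw [← map_add]
  congr 1
  rw [ContinuousLinearMap.coe_coe, ContinuousLinearMap.comp_apply,
    hG.fderiv_confVec_apply hc hc0 hx]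
  -- `DG(bᵢ)(T) = G(Γ(bᵢ,T), ·) + θ ∘ Γ(bᵢ, ·)`
  have hKey : fderiv ℝ G x (b i) (confVec G c x) =
      G x (chrAt G x (b i) (confVec G c x))
        + (confForm c x).comp (chrAt G x (b i)) := by
    ext w
    rw [hG.fderiv_eq_chrAt hx, _root_.add_apply, ContinuousLinearMap.comp_apply,
      apply_confVec hi]
  have hH : confHess G c x (b i) =
      fderiv ℝ (confForm c) x (b i) - (confForm c x).comp (chrAt G x (b i)) := by
    ext w
    simp [confHess]
  rw [hKey, hH, map_add, map_sub, sharpAt_apply hi]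
  abel

/-- `G(∂_Y T, Z) = Dθ(Y)(Z) − ∂_Y G(T, Z)`. [folklore] -/
theorem IsMetricOn.apply_fderiv_confVec [CompleteSpace E] (hG : IsMetricOn G V)
    (hc : ContDiffOn ℝ ∞ c V)
    (hc0 : ∀ y ∈ V, c y ≠ 0) (hx : x ∈ V) (Y Z : E) :
    G x (fderiv ℝ (confVec G c) x Y) Z =
      fderiv ℝ (confForm c) x Y Z - fderiv ℝ G x Y (confVec G c x) Z := by
  have hi := hG.isInvertible x hx
  rw [hG.fderiv_confVec_apply hc hc0 hx, map_sub, _root_.sub_apply, apply_sharpAt_apply hi,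
    apply_sharpAt_apply hi]

/-- Trace of the block `X ↦ ∂_X C(Y, Z)`:
`∑ᵢ bⁱ(∂_{bᵢ} C(Y,Z)) = Dθ(Z)(Y) + Dθ(Y)(Z) − ∂_T G(Y,Z) − G(Y,Z) ∑ᵢ bⁱ(∂_{bᵢ} T)`. [folklore] -/
theorem sum_coord_block₁ (Y Z : E) :
    ∑ i, b.coord i
        (fderiv ℝ (confForm c) x (b i) Y • Z + fderiv ℝ (confForm c) x (b i) Z • Y
          - (fderiv ℝ G x (b i) Y Z • confVec G c x + G x Y Z • fderiv ℝ (confVec G c) x (b i))) =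
      fderiv ℝ (confForm c) x Z Y + fderiv ℝ (confForm c) x Y Z
        - fderiv ℝ G x (confVec G c x) Y Z
        - G x Y Z * ∑ i, b.coord i (fderiv ℝ (confVec G c) x (b i)) := by
  simp only [map_add, map_sub, map_smul, smul_eq_mul, Finset.sum_add_distrib,
    Finset.sum_sub_distrib, sum_clm₂_mul_coord, sum_clm₃_mul_coord, ← Finset.mul_sum]
  ring

/-- Trace of the block `X ↦ ∂_Y C(X, Z)`:
`∑ᵢ bⁱ(∂_Y C(bᵢ,Z)) = Dθ(Y)(Z) + n Dθ(Y)(Z) − ∂_Y G(T,Z) − G(∂_Y T, Z)`. [folklore] -/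
theorem sum_coord_block₂ (Y Z : E) :
    ∑ i, b.coord i
        (fderiv ℝ (confForm c) x Y (b i) • Z + fderiv ℝ (confForm c) x Y Z • b i
          - (fderiv ℝ G x Y (b i) Z • confVec G c x + G x (b i) Z • fderiv ℝ (confVec G c) x Y)) =
      fderiv ℝ (confForm c) x Y Z + Fintype.card ι * fderiv ℝ (confForm c) x Y Z
        - fderiv ℝ G x Y (confVec G c x) Z
        - G x (fderiv ℝ (confVec G c) x Y) Z := by
  simp only [map_add, map_sub, map_smul, smul_eq_mul, Finset.sum_add_distrib,
    Finset.sum_sub_distrib, sum_clm_mul_coord, sum_clm₂_mul_coord, sum_mul_coord_self]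
  ring

/-- Trace of the block `X ↦ Γ(X, C(Y,Z))`. [folklore] -/
theorem sum_coord_block₃ (Y Z : E) :
    ∑ i, b.coord i (chrAt G x (b i) (confDiff G c x Y Z)) =
      confForm c x Y * ∑ i, b.coord i (chrAt G x (b i) Z)
        + confForm c x Z * ∑ i, b.coord i (chrAt G x (b i) Y)
        - G x Y Z * ∑ i, b.coord i (chrAt G x (b i) (confVec G c x)) := by
  simp only [confDiff, map_add, map_sub, map_smul, smul_eq_mul, Finset.sum_add_distrib,
    Finset.sum_sub_distrib, ← Finset.mul_sum]

/-- **Trace of `X ↦ C(X, W)`**: `∑ᵢ bⁱ(C(bᵢ, W)) = n θ(W)` (`n = card ι = dim E`). [folklore] -/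
theorem sum_coord_confDiff_left (hx : (G x).IsInvertible) (W : E) :
    ∑ i, b.coord i (confDiff G c x (b i) W) = Fintype.card ι * confForm c x W := by
  simp only [confDiff, map_add, map_sub, map_smul, smul_eq_mul, Finset.sum_add_distrib,
    Finset.sum_sub_distrib, sum_clm_mul_coord, sum_clm₂_mul_coord, sum_mul_coord_self,
    apply_confVec hx]
  ring

/-- Trace of the block `X ↦ Γ(Y, C(X, Z))`. [folklore] -/
theorem sum_coord_block₆ (Y Z : E) :
    ∑ i, b.coord i (chrAt G x Y (confDiff G c x (b i) Z)) =
      confForm c x (chrAt G x Y Z) + confForm c x Z * ∑ i, b.coord i (chrAt G x Y (b i))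
        - G x (chrAt G x Y (confVec G c x)) Z := by
  simp only [confDiff, map_add, map_sub, map_smul, smul_eq_mul, Finset.sum_add_distrib,
    Finset.sum_sub_distrib, sum_clm_mul_coord, sum_clm₂_mul_coord, ← Finset.mul_sum]

/-- Trace of the block `X ↦ C(Y, Γ(X, Z))`. [folklore] -/
theorem sum_coord_block₇ (Y Z : E) :
    ∑ i, b.coord i (confDiff G c x Y (chrAt G x (b i) Z)) =
      confForm c x Y * ∑ i, b.coord i (chrAt G x (b i) Z) + confForm c x (chrAt G x Y Z)
        - G x Y (chrAt G x (confVec G c x) Z) := by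
  have h1 : ∑ i, confForm c x (chrAt G x (b i) Z) * b.coord i Y = confForm c x (chrAt G x Y Z) :=
    sum_fun_mul_coord b (fun v ↦ confForm c x (chrAt G x v Z))
      (fun v w ↦ by simp only [map_add, _root_.add_apply])
      (fun a v ↦ by simp only [map_smul, _root_.smul_apply, smul_eq_mul]) Y
  have h2 : ∑ i, G x Y (chrAt G x (b i) Z) * b.coord i (confVec G c x) =
      G x Y (chrAt G x (confVec G c x) Z) :=
    sum_fun_mul_coord b (fun v ↦ G x Y (chrAt G x v Z))
      (fun v w ↦ by simp only [map_add, _root_.add_apply])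
      (fun a v ↦ by simp only [map_smul, _root_.smul_apply, smul_eq_mul]) (confVec G c x)
  simp only [confDiff, map_add, map_sub, map_smul, smul_eq_mul, Finset.sum_add_distrib,
    Finset.sum_sub_distrib, ← Finset.mul_sum, h1, h2]

omit [Fintype ι] in
/-- The coordinates of `C(Y, W)`: `bⁱ(C(Y,W)) = θ(Y) bⁱ(W) + θ(W) bⁱ(Y) − G(Y,W) bⁱ(T)`.
[folklore] -/
theorem coord_confDiff (i : ι) (Y W : E) :
    b.coord i (confDiff G c x Y W) =
      confForm c x Y * b.coord i W + confForm c x W * b.coord i Y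
        - G x Y W * b.coord i (confVec G c x) := by
  simp only [confDiff, map_add, map_sub, map_smul, smul_eq_mul]

/-- `G(Y, C(T, Z)) = |θ|² G(Y, Z)` for symmetric `G_x`. [folklore] -/
theorem apply_confDiff_confVec (hx : (G x).IsInvertible) (hs : ∀ v w : E, G x v w = G x w v)
    (Y Z : E) :
    G x Y (confDiff G c x (confVec G c x) Z) = confForm c x (confVec G c x) * G x Y Z := by
  simp only [confDiff, map_add, map_sub, map_smul, smul_eq_mul, apply_confVec hx,
    apply_apply_confVec hx hs]
  ring

/-- **Trace of the block `X ↦ C(Y, C(X, Z))`**: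
`∑ᵢ bⁱ(C(Y, C(bᵢ, Z))) = (n + 2) θ(Y) θ(Z) − 2 |θ|² G(Y,Z)`. [folklore] -/
theorem sum_coord_block₈ (hx : (G x).IsInvertible) (hs : ∀ v w : E, G x v w = G x w v)
    (Y Z : E) :
    ∑ i, b.coord i (confDiff G c x Y (confDiff G c x (b i) Z)) =
      (Fintype.card ι + 2) * (confForm c x Y * confForm c x Z)
        - 2 * (confForm c x (confVec G c x) * G x Y Z) := by
  have h1 : ∑ i, confForm c x (confDiff G c x (b i) Z) * b.coord i Y =
      confForm c x (confDiff G c x Y Z) :=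
    sum_fun_mul_coord b (fun v ↦ confForm c x (confDiff G c x v Z))
      (fun v w ↦ by rw [confDiff_add_left, map_add])
      (fun a v ↦ by rw [confDiff_smul_left, map_smul, smul_eq_mul]) Y
  have h2 : ∑ i, G x Y (confDiff G c x (b i) Z) * b.coord i (confVec G c x) =
      G x Y (confDiff G c x (confVec G c x) Z) :=
    sum_fun_mul_coord b (fun v ↦ G x Y (confDiff G c x v Z))
      (fun v w ↦ by rw [confDiff_add_left, map_add])
      (fun a v ↦ by rw [confDiff_smul_left, map_smul, smul_eq_mul]) (confVec G c x)
  rw [Finset.sum_congr rfl fun i _ ↦ coord_confDiff b i Y (confDiff G c x (b i) Z),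
    Finset.sum_sub_distrib, Finset.sum_add_distrib, ← Finset.mul_sum,
    sum_coord_confDiff_left b hx, h1, h2, confForm_confDiff, apply_confDiff_confVec hx hs]
  ring

end Traces

/-! ### The Ricci tensor and the scalar curvature of a conformal metric -/

section RicciScalar

variable [FiniteDimensional ℝ E] [CompleteSpace E] {G : E → E →L[ℝ] E →L[ℝ] ℝ} {V : Set E}
  {x : E} {c : E → ℝ}

/-- **The Ricci tensor of a conformal metric** (Besse 1987, Thm. 1.159 (d): for `g' = e^{2f} g`
on an `n`-manifold, `Ric' = Ric − (n−2)(∇df − df∘df) + (Δf − (n−2)|df|²) g` in Besse's sign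
convention `Δ = −tr ∇d`). Here `c = e^{2f}`, `θ = df = dc/(2c)`, `T = θ♯`, `H = ∇df`
(`confHess`), `n = dim E`:
`Ric'(Y,Z) = Ric(Y,Z) − (n−2) H(Y,Z) + (n−2) θ(Y)θ(Z) − ((n−2) θ(T) + tr_G H) G(Y,Z)`.
Proof: the trace of `X ↦ (R' − R)(X,Y)Z` (`riemAt_conformal_apply`) in a basis, block by block
(`sum_coord_block₃`–`sum_coord_block₈`), metric compatibility and torsion-freeness of `Γ`, the
symmetry of `Dθ`, and `tr ∇T = tr_G H` (`sum_coord_fderiv_confVec`).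
[cite: Besse1987, Thm. 1.159 (d)] -/
theorem IsMetricOn.ricAt_conformal (hG : IsMetricOn G V) (hc : ContDiffOn ℝ ∞ c V)
    (hc0 : ∀ y ∈ V, c y ≠ 0) (hx : x ∈ V) (Y Z : E) :
    ricAt (fun y ↦ c y • G y) x Y Z =
      ricAt G x Y Z - (Module.finrank ℝ E - 2 : ℝ) * confHess G c x Y Z
        + (Module.finrank ℝ E - 2 : ℝ) * (confForm c x Y * confForm c x Z)
        - ((Module.finrank ℝ E - 2 : ℝ) * confForm c x (confVec G c x)
            + mtrAt G x (confHess G c x)) * G x Y Z := by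
  have hi := hG.isInvertible x hx
  have hs := hG.symm x hx
  set b := Module.finBasis ℝ E with hb
  -- the identities used in the final combination
  have hn : (Fintype.card (Fin (Module.finrank ℝ E)) : ℝ) = Module.finrank ℝ E := by simp
  have hsym : fderiv ℝ (confForm c) x Z Y = fderiv ℝ (confForm c) x Y Z :=
    hG.fderiv_confForm_comm hc hc0 hx Z Y
  have hP : fderiv ℝ G x (confVec G c x) Y Z =
      G x (chrAt G x (confVec G c x) Y) Z + G x Y (chrAt G x (confVec G c x) Z) :=
    hG.fderiv_eq_chrAt hx _ Y Z
  have hU : G x (fderiv ℝ (confVec G c) x Y) Z =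
      fderiv ℝ (confForm c) x Y Z - fderiv ℝ G x Y (confVec G c x) Z :=
    hG.apply_fderiv_confVec hc hc0 hx Y Z
  have hJ : G x (chrAt G x (confVec G c x) Y) Z = G x (chrAt G x Y (confVec G c x)) Z := by
    rw [hG.chrAt_comm hx]
  have hτ : ∑ i, b.coord i (chrAt G x Y (b i)) = ∑ i, b.coord i (chrAt G x (b i) Y) :=
    Finset.sum_congr rfl fun i _ ↦ by rw [hG.chrAt_comm hx]
  have hM := hG.sum_coord_fderiv_confVec b hc hc0 hx
  have hH : confHess G c x Y Z = fderiv ℝ (confForm c) x Y Z - confForm c x (chrAt G x Y Z) :=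
    confHess_apply x Y Z
  -- expand the trace of `R'` in the basis `b`
  rw [ricAt_eq_sum_coord b, ricAt_eq_sum_coord b]
  simp only [hG.riemAt_conformal_apply hc hc0 hx, map_add, map_sub, map_smul, smul_eq_mul,
    Finset.sum_add_distrib, Finset.sum_sub_distrib, sum_clm_mul_coord, sum_clm₂_mul_coord,
    sum_clm₃_mul_coord, sum_coord_self, ← Finset.mul_sum, sum_coord_block₃,
    sum_coord_confDiff_left b hi, sum_coord_block₆, sum_coord_block₇, sum_coord_block₈ b hi hs,
    confForm_confDiff]
  rw [hn] at *
  linear_combination hsym - hP + hU - hJ - confForm c x Z * hτ - G x Y Z * hM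
    + ((Module.finrank ℝ E : ℝ) - 2) * hH


omit [FiniteDimensional ℝ E] [CompleteSpace E] in
/-- **The metric trace for the conformal components**: `tr_{cG} β = c⁻¹ tr_G β`. [folklore] -/
theorem mtrAt_conformal (hx : (G x).IsInvertible) (hx' : ((fun y ↦ c y • G y) x).IsInvertible)
    (hcx : c x ≠ 0) (β : E →L[ℝ] E →L[ℝ] ℝ) :
    mtrAt (fun y ↦ c y • G y) x β = (c x)⁻¹ * mtrAt G x β := by
  have h : (sharpAt (fun y ↦ c y • G y) x).comp β = (c x)⁻¹ • (sharpAt G x).comp β := by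
    ext v
    simp only [ContinuousLinearMap.comp_apply, _root_.smul_apply, sharpAt_conformal hx hx' hcx]
  rw [mtrAt, h, ContinuousLinearMap.toLinearMap_smul, map_smul, smul_eq_mul]
  rfl

omit [CompleteSpace E] in
/-- **The metric trace of a tensor product of one-forms**: `tr_G (α ⊗ β) = α(β♯)`
(`g^{ij} αᵢ βⱼ`). [folklore] -/
theorem mtrAt_smulRight (α β : E →L[ℝ] ℝ) : mtrAt G x (α.smulRight β) = α (sharpAt G x β) := by
  set b := Module.finBasis ℝ E
  rw [mtrAt_eq_sum b]
  simp only [ContinuousLinearMap.smulRight_apply, _root_.smul_apply, smul_eq_mul]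
  calc ∑ i, ∑ j, ginv G b x i j * (α (b i) * β (b j))
        = ∑ i, α (b i) * ∑ j, ginv G b x i j * β (b j) := by
          refine Finset.sum_congr rfl fun i _ ↦ ?_
          rw [Finset.mul_sum]
          exact Finset.sum_congr rfl fun j _ ↦ by ring
      _ = ∑ i, α (b i) * b.coord i (sharpAt G x β) := by
          refine Finset.sum_congr rfl fun i _ ↦ ?_
          rw [coord_sharpAt_eq_sum]
      _ = α (sharpAt G x β) := sum_clm_mul_coord b α _

omit [CompleteSpace E] in
/-- **The metric trace of the metric is the dimension**: `tr_G G = g^{ij} g_{ij} = n`. [folklore] -/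
theorem mtrAt_self (hx : (G x).IsInvertible) : mtrAt G x (G x) = Module.finrank ℝ E := by
  have h : (((sharpAt G x).comp (G x) : E →L[ℝ] E) : E →ₗ[ℝ] E) = LinearMap.id := by
    ext v
    simp [sharpAt_apply hx]
  rw [mtrAt, h, LinearMap.trace_id]

/-- The Ricci form of a conformal metric, as an identity of bilinear forms
(`ricAt_conformal`). [cite: Besse1987, Thm. 1.159 (d)] -/
theorem IsMetricOn.ricAt_conformal_eq (hG : IsMetricOn G V) (hc : ContDiffOn ℝ ∞ c V)
    (hc0 : ∀ y ∈ V, c y ≠ 0) (hx : x ∈ V) :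
    ricAt (fun y ↦ c y • G y) x =
      ricAt G x - (Module.finrank ℝ E - 2 : ℝ) • confHess G c x
        + (Module.finrank ℝ E - 2 : ℝ) • (confForm c x).smulRight (confForm c x)
        - ((Module.finrank ℝ E - 2 : ℝ) * confForm c x (confVec G c x)
            + mtrAt G x (confHess G c x)) • G x := by
  ext Y Z
  rw [hG.ricAt_conformal hc hc0 hx Y Z]
  simp only [_root_.add_apply, _root_.sub_apply, _root_.smul_apply, smul_eq_mul,
    ContinuousLinearMap.smulRight_apply]

/-- **The scalar curvature of a conformal metric** (Besse 1987, Thm. 1.159 (f): for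
`g' = e^{2f} g`, `S' = e^{−2f}(S + 2(n−1)Δf − (n−2)(n−1)|df|²)` with Besse's `Δ = −tr ∇d`). Here
`c = e^{2f}`, `θ = df`, `T = θ♯`, `H = ∇df`, `n = dim E`:
`S' = c⁻¹ (S − 2(n−1) tr_G H − (n−2)(n−1) θ(T))`. [cite: Besse1987, Thm. 1.159 (f)] -/
theorem IsMetricOn.scalAt_conformal (hG : IsMetricOn G V) (hc : ContDiffOn ℝ ∞ c V)
    (hc0 : ∀ y ∈ V, c y ≠ 0) (hx : x ∈ V) :
    scalAt (fun y ↦ c y • G y) x =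
      (c x)⁻¹ * (scalAt G x - 2 * (Module.finrank ℝ E - 1 : ℝ) * mtrAt G x (confHess G c x)
        - (Module.finrank ℝ E - 2 : ℝ) * (Module.finrank ℝ E - 1 : ℝ)
            * confForm c x (confVec G c x)) := by
  have hi := hG.isInvertible x hx
  have hi' := (isMetricOn_conformal hG hc hc0).isInvertible x hx
  rw [scalAt, mtrAt_conformal hi hi' (hc0 x hx), hG.ricAt_conformal_eq hc hc0 hx, mtrAt_sub,
    mtrAt_add, mtrAt_sub, mtrAt_smul, mtrAt_smul, mtrAt_smul, mtrAt_smulRight, mtrAt_self hi,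
    ← scalAt]
  simp only [confVec]
  ring

end RicciScalar

/-! ### Dimension three, `c = ψ⁴`: `S(ψ⁴ G) = ψ⁻⁵ (S(G) ψ − 8 Δ_G ψ)` -/

section FourthPower

variable [FiniteDimensional ℝ E] [CompleteSpace E] {G : E → E →L[ℝ] E →L[ℝ] ℝ} {ψ : E → ℝ}
  {V : Set E} {x : E}

omit [FiniteDimensional ℝ E] [CompleteSpace E] in
/-- For `c = ψ⁴`: `θ = dc/(2c) = 2 dψ/ψ`. [folklore] -/
theorem confForm_fourth_power {y : E} (hψ : DifferentiableAt ℝ ψ y) (hψ0 : ψ y ≠ 0) :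
    confForm (fun z ↦ ψ z ^ 4) y = (2 * (ψ y)⁻¹) • fderiv ℝ ψ y := by
  have h4 : fderiv ℝ (fun z ↦ ψ z ^ 4) y = ((4 : ℕ) • ψ y ^ (4 - 1)) • fderiv ℝ ψ y :=
    (hψ.hasFDerivAt.pow 4).fderiv
  rw [confForm, h4, smul_smul]
  congr 1
  rw [nsmul_eq_mul]
  field_simp
  norm_num

omit [FiniteDimensional ℝ E] [CompleteSpace E] in
/-- For `c = ψ⁴` the derivative of `θ = 2 dψ/ψ` is
`Dθ(x)(v)(w) = 2 D²ψ(v,w)/ψ − 2 ∂_vψ ∂_wψ/ψ²`. [folklore] -/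
theorem IsMetricOn.fderiv_confForm_fourth_power (hG : IsMetricOn G V) (hψ : ContDiffOn ℝ ∞ ψ V)
    (hψ0 : ∀ y ∈ V, ψ y ≠ 0) (hx : x ∈ V) :
    fderiv ℝ (confForm (fun z ↦ ψ z ^ 4)) x =
      (2 * (ψ x)⁻¹) • fderiv ℝ (fderiv ℝ ψ) x
        - (2 * (ψ x ^ 2)⁻¹) • (fderiv ℝ ψ x).smulRight (fderiv ℝ ψ x) := by
  have hψx : ContDiffAt ℝ ∞ ψ x := hG.contDiffAt_of_contDiffOn hψ hx
  have hd : HasFDerivAt ψ (fderiv ℝ ψ x) x := (hψx.differentiableAt (by simp)).hasFDerivAt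
  have heq : confForm (fun z ↦ ψ z ^ 4) =ᶠ[𝓝 x] fun y ↦ (2 * (ψ y)⁻¹) • fderiv ℝ ψ y :=
    (hG.eventually_mem hx).mono fun y hy ↦
      confForm_fourth_power (hG.differentiableAt_of_contDiffOn hψ hy) (hψ0 y hy)
  have hinv : HasFDerivAt (fun y ↦ (ψ y)⁻¹) ((-(ψ x ^ 2)⁻¹) • fderiv ℝ ψ x) x :=
    (hasDerivAt_inv (hψ0 x hx)).comp_hasFDerivAt x hd
  have hcoef : HasFDerivAt (fun y ↦ 2 * (ψ y)⁻¹) ((2 : ℝ) • ((-(ψ x ^ 2)⁻¹) • fderiv ℝ ψ x)) x :=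
    hinv.const_mul 2
  have hD : HasFDerivAt (fderiv ℝ ψ) (fderiv ℝ (fderiv ℝ ψ) x) x :=
    ((hψx.fderiv_right (m := ∞) (by simp)).differentiableAt (by simp)).hasFDerivAt
  have hθ' : HasFDerivAt (fun y ↦ (2 * (ψ y)⁻¹) • fderiv ℝ ψ y)
      ((2 * (ψ x)⁻¹) • fderiv ℝ (fderiv ℝ ψ) x
        + ((2 : ℝ) • ((-(ψ x ^ 2)⁻¹) • fderiv ℝ ψ x)).smulRight (fderiv ℝ ψ x)) x :=
    hcoef.smul hD
  rw [heq.fderiv_eq, hθ'.fderiv]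
  ext v w
  simp only [_root_.add_apply, _root_.sub_apply, _root_.smul_apply, smul_eq_mul,
    ContinuousLinearMap.smulRight_apply]
  ring

omit [FiniteDimensional ℝ E] [CompleteSpace E] in
/-- For `c = ψ⁴`: the covariant Hessian of `f = 2 log |ψ|` is
`H = 2 Hess_G ψ/ψ − 2 dψ ⊗ dψ/ψ²`. [folklore] -/
theorem IsMetricOn.confHess_fourth_power (hG : IsMetricOn G V) (hψ : ContDiffOn ℝ ∞ ψ V)
    (hψ0 : ∀ y ∈ V, ψ y ≠ 0) (hx : x ∈ V) :
    confHess G (fun z ↦ ψ z ^ 4) x =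
      (2 * (ψ x)⁻¹) • hessAt G ψ x
        - (2 * (ψ x ^ 2)⁻¹) • (fderiv ℝ ψ x).smulRight (fderiv ℝ ψ x) := by
  ext v w
  rw [confHess_apply, hG.fderiv_confForm_fourth_power hψ hψ0 hx,
    confForm_fourth_power (hG.differentiableAt_of_contDiffOn hψ hx) (hψ0 x hx)]
  simp only [_root_.sub_apply, _root_.smul_apply, smul_eq_mul,
    ContinuousLinearMap.smulRight_apply, hessAt_apply]
  ring

/-- **The scalar curvature of `ψ⁴ G` in dimension three: `S(ψ⁴ G) = ψ⁻⁵ (S(G) ψ − 8 Δ_G ψ)`.**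
For metric components `G` on `V ⊆ E`, `dim E = 3`, and `ψ` smooth and nowhere zero on `V`,
at every `x ∈ V`: `scalAt (ψ⁴ G) x = (ψ x)⁻⁵ (scalAt G x · ψ x − 8 lapAt G ψ x)` with
`lapAt G ψ = tr_G (D²ψ − Dψ ∘ Γ)` the Laplace–Beltrami operator of `G` in coordinates. This is
the transformation law quoted by Schoen–Yau (Comm. Math. Phys. 65 (1979), §2, Step 1, p. 49:
"The well-known formula for the scalar curvature `R̃` [of `d̃s² = φ⁴ ds²`] is
`R̃ = φ⁻⁵(−8Δφ + Rφ)`"), Aubin's `4((n−1)/(n−2)) Δφ + Rφ = R'φ^{(n+2)/(n−2)}` at `n = 3`, and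
Besse 1987, Thm. 1.159 (f) with `e^{2f} = ψ⁴`; obtained from `scalAt_conformal` with `c = ψ⁴`,
`θ = 2dψ/ψ`, `H = 2 Hess ψ/ψ − 2 dψ⊗dψ/ψ²`. [cite: SchoenYauPMT1979, §2 Step 1 (p. 49)] -/
theorem IsMetricOn.scalAt_conformal_fourth_power (hG : IsMetricOn G V) (hψ : ContDiffOn ℝ ∞ ψ V)
    (hψ0 : ∀ y ∈ V, ψ y ≠ 0) (hx : x ∈ V) (h3 : Module.finrank ℝ E = 3) :
    scalAt (fun y ↦ ψ y ^ 4 • G y) x =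
      (ψ x ^ 5)⁻¹ * (scalAt G x * ψ x - 8 * lapAt G ψ x) := by
  have hc : ContDiffOn ℝ ∞ (fun z ↦ ψ z ^ 4) V := hψ.pow 4
  have hc0 : ∀ y ∈ V, ψ y ^ 4 ≠ 0 := fun y hy ↦ pow_ne_zero 4 (hψ0 y hy)
  have hψx := hψ0 x hx
  rw [hG.scalAt_conformal hc hc0 hx, hG.confHess_fourth_power hψ hψ0 hx, mtrAt_sub, mtrAt_smul,
    mtrAt_smul, mtrAt_smulRight, confVec,
    confForm_fourth_power (hG.differentiableAt_of_contDiffOn hψ hx) hψx, map_smul, map_smul,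
    _root_.smul_apply, h3, ← lapAt]
  simp only [smul_eq_mul, Nat.cast_ofNat]
  field_simp
  ring

end FourthPower

end MetricCoord

end Literature.Geometry.Lorentzian

end
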